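import Literature.NumberTheory.ModularForms.LevelOneEisensteinCongruencesRankOne
import Literature.NumberTheory.ModularForms.RamanujanCongruence691
import HarnessLib

/-!
# Manin's congruences in the printed convolution form: `f_k = Δ·E_{k−12}` for `k = 16, 18, 20, 22, 26`
# (Datskovsky–Guerzhoy, the list after Cor. 1.1)

B. Datskovsky, P. Guerzhoy, *On Ramanujan congruences for modular forms of integral and half-integral weights*,
Proc. Amer. Math. Soc. **124** (1996), p. 2285, verbatim:

> "When `k = 12`, Corollary 1.1 yields the Ramanujan congruence modulo `691`. For `k = 16, 18, 20, 22`, and `26`, it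
> implies the following congruences, first obtained by Manin [9]:
> `σ₁₅(n) ≡ τ(n) + 240 Σ_{m=1}^{n−1} σ₃(m)τ(n−m) mod 3617`;
> `σ₁₇(n) ≡ τ(n) − 504 Σ_{m=1}^{n−1} σ₅(m)τ(n−m) mod 43867`;
> `σ₁₉(n) ≡ τ(n) + 480 Σ_{m=1}^{n−1} σ₇(m)τ(n−m) mod 283·617`;
> `σ₂₁(n) ≡ τ(n) − 264 Σ_{m=1}^{n−1} σ₉(m)τ(n−m) mod 131·593`;
> `σ₂₅(n) ≡ τ(n) − 24 Σ_{m=1}^{n−1} σ₁₃(m)τ(n−m) mod 657931`."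

Everything is PROVED: in the one-dimensional weights `k = 12 + m`, `m ∈ {4, 6, 8, 10, 14}`, the normalized eigenform is
`f_k = Δ·E_m` (`E_m = 1 + C_m Σ σ_{m−1}(j)q^j`, `C_m = −2m/B_m = 240, −504, 480, −264, −24`), whose `n`-th coefficient
is the Cauchy product `τ(n) + C_m Σ_{j=1}^{n−1} σ_{m−1}(j) τ(n−j)` (`τ(0) = 0`, `E_m` has constant term `1`); Cor. 1.1
in the form of the tree's `IsNormalizedCuspEigenform.congr_sigma_of_weight_mem` (file
`LevelOneEisensteinCongruencesRankOne`, with `N₁₆ = 3617, …, N₂₆ = 657931`) then gives the five congruences exactly as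
printed, with Ramanujan's `τ` the tree's `ramanujanTau` (file `RamanujanCongruence691`).

## Contents (one definition with body + theorems; no named fact)

* `deltaMulE hm : CuspForm 𝒮ℒ (12 + m)` (`Δ·E_m`), `qExpansion_coeff_deltaMulE` (the Cauchy product with `τ`),
  `isNormalizedCuspEigenform_deltaMulE` (for `12 + m ∈ {16, 18, 20, 22, 26}`), `coeff_deltaMulE_eq_convolution`
  (`a_n(ΔE_m) = τ(n) + C_m Σ_{j=1}^{n−1} σ_{m−1}(j)τ(n−j)` once `−2m/B_m = C_m ∈ ℤ`);
* ★**`manin_sixteen`**, ★**`manin_eighteen`**, ★**`manin_twenty`**, ★**`manin_twentyTwo`**, ★**`manin_twentySix`** —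
  the five printed congruences.

## References

* [DatskovskyGuerzhoy1996] B. Datskovsky, P. Guerzhoy, Proc. AMS 124 (1996), the list after Cor. 1.1 (p. 2285).
* [Manin1973] Ju. I. Manin, *Periods of parabolic forms and p-adic Hecke series*, Math. USSR Sb. 21 (1973) (ref. 9 of DG).
* [Serre1973] J.-P. Serre, *A Course in Arithmetic*, GTM 7, Ch. VII §4.1 (34) (`E_k`), §5.5 Remark (`ΔG₂, …, ΔG₇`).
-/

noncomputable section

open scoped MatrixGroups ModularForm
open UpperHalfPlane hiding I
open ArithmeticFunction (sigma sigma_one)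

namespace Literature.NumberTheory.ModularForms

/-! ## §1 The cusp forms `Δ·E_m` -/

section DeltaMulE

variable {m : ℕ}

/-- The `q`-expansion of `Δ·E_m` (as a modular form of weight `12 + m`) is the product of those of `Δ` and `E_m`.
[cite: Serre1973, Ch. VII §5.5 Remark (the basis `ΔG_k`)] -/
theorem qExpansion_discriminantForm_mul_E (hm : 3 ≤ m) :
    qExpansion 1 ⇑((discriminantForm.mul (ModularForm.E hm)).mcast (by push_cast; ring) :
        ModularForm 𝒮ℒ ((12 + m : ℕ) : ℤ)) =
      qExpansion 1 ModularForm.discriminant * qExpansion 1 ⇑(ModularForm.E hm) := by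
  rw [ModularForm.qExpansion_mcast, ModularForm.qExpansion_mul one_pos one_mem_strictPeriods_SL, coe_discriminantForm]

/-- The constant term of `Δ·E_m` vanishes. [cite: Serre1973, Ch. VII §5.5 Remark] -/
theorem qExpansion_coeff_zero_discriminantForm_mul_E (hm : 3 ≤ m) :
    (qExpansion 1 ⇑((discriminantForm.mul (ModularForm.E hm)).mcast (by push_cast; ring) :
        ModularForm 𝒮ℒ ((12 + m : ℕ) : ℤ))).coeff 0 = 0 := by
  rw [qExpansion_discriminantForm_mul_E, PowerSeries.coeff_zero_eq_constantCoeff, map_mul,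
    ← PowerSeries.coeff_zero_eq_constantCoeff_apply, coeff_qExpansion_discriminant_eq_ramanujanTau, ramanujanTau_zero,
    Int.cast_zero, zero_mul]

/-- **`Δ·E_m` as a cusp form of weight `12 + m`** (`m ≥ 4` even; Serre's `ΔG_{m/2}` up to the normalisation of `E_m`).
[cite: Serre1973, Ch. VII §5.5 Remark ("basis `Δ, ΔG₂, ΔG₃, ΔG₄, ΔG₅` and `ΔG₇`")] [cite: DatskovskyGuerzhoy1996,
Cor. 1.1 (list)] -/
def deltaMulE (hm : 3 ≤ m) : CuspForm 𝒮ℒ ((12 + m : ℕ) : ℤ) :=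
  ModularForm.toCuspForm ((discriminantForm.mul (ModularForm.E hm)).mcast (by push_cast; ring))
    (qExpansion_coeff_zero_discriminantForm_mul_E hm)

/-- ★ **The coefficients of `Δ·E_m`**: `a_n(ΔE_m) = Σ_{j=0}^{n} τ(n−j) e_m(j)` with `e_m(0) = 1`,
`e_m(j) = −(2m/B_m)σ_{m−1}(j)`. [cite: Serre1973, Ch. VII §4.1 (34), §4.5 (50)] -/
theorem qExpansion_coeff_deltaMulE (hm : 3 ≤ m) (hm2 : Even m) (n : ℕ) :
    (qExpansion 1 ⇑(deltaMulE hm)).coeff n =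
      ∑ j ∈ Finset.range (n + 1), (ramanujanTau (n - j) : ℂ) *
        (if j = 0 then 1 else -(2 * m / bernoulli m : ℂ) * (sigma (m - 1) j : ℂ)) := by
  change (qExpansion 1 ⇑((discriminantForm.mul (ModularForm.E hm)).mcast (by push_cast; ring) :
    ModularForm 𝒮ℒ ((12 + m : ℕ) : ℤ))).coeff n = _
  rw [qExpansion_discriminantForm_mul_E, PowerSeries.coeff_mul, ← Finset.Nat.sum_antidiagonal_swap,
    Finset.Nat.sum_antidiagonal_eq_sum_range_succ_mk]
  refine Finset.sum_congr rfl fun j _ => ?_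
  rw [Prod.swap_prod_mk, coeff_qExpansion_discriminant_eq_ramanujanTau, EisensteinSeries.E_qExpansion_coeff hm hm2]

/-- `a₁(Δ·E_m) = τ(1)·1 = 1`. [cite: Serre1973, Ch. VII §4.5 (50)] -/
theorem qExpansion_coeff_one_deltaMulE (hm : 3 ≤ m) (hm2 : Even m) : (qExpansion 1 ⇑(deltaMulE hm)).coeff 1 = 1 := by
  rw [qExpansion_coeff_deltaMulE hm hm2, Finset.sum_range_succ, Finset.sum_range_one]
  simp [ramanujanTau_zero, ramanujanTau_one]

/-- ★ **`Δ·E_m` is the normalized eigenform of weight `12 + m ∈ {16, 18, 20, 22, 26}`** (these spaces are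
one-dimensional, so every form is an eigenform, and `a₁(ΔE_m) = 1`). [cite: Serre1973, Ch. VII §5.5 Remark]
[cite: DatskovskyGuerzhoy1996, Cor. 1.1 ("the unique cusp form of weight `k` normalized …")] -/
theorem isNormalizedCuspEigenform_deltaMulE (hm : 3 ≤ m) (hm2 : Even m)
    (hk : ((12 + m : ℕ) : ℤ) = 16 ∨ ((12 + m : ℕ) : ℤ) = 18 ∨ ((12 + m : ℕ) : ℤ) = 20 ∨ ((12 + m : ℕ) : ℤ) = 22 ∨
      ((12 + m : ℕ) : ℤ) = 26) :
    IsNormalizedCuspEigenform (deltaMulE hm) := by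
  rw [isNormalizedCuspEigenform_iff]
  exact ⟨fun n hn => exists_heckeTCusp_eq_smul_of_weight_mem (Or.inr hk) hn _, qExpansion_coeff_one_deltaMulE hm hm2⟩

/-- ★ **The convolution form**: if `−2m/B_m = C ∈ ℤ` then for `n ≥ 1`
`a_n(Δ·E_m) = τ(n) + C Σ_{j=1}^{n−1} σ_{m−1}(j) τ(n−j)` (the terms `j = 0` and `j = n` of the Cauchy product are
`τ(n)` and `τ(0)e_m(n) = 0`). [cite: DatskovskyGuerzhoy1996, Cor. 1.1 (the displayed right-hand sides)] -/
theorem coeff_deltaMulE_eq_convolution (hm : 3 ≤ m) (hm2 : Even m) {C : ℤ} (hC : -(2 * m / bernoulli m : ℂ) = (C : ℂ))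
    {n : ℕ} (hn : 0 < n) :
    (qExpansion 1 ⇑(deltaMulE hm)).coeff n =
      ((ramanujanTau n + C * ∑ j ∈ Finset.Ioo 0 n, (sigma (m - 1) j : ℤ) * ramanujanTau (n - j) : ℤ) : ℂ) := by
  rw [qExpansion_coeff_deltaMulE hm hm2, hC]
  -- split off `j = 0` and `j = n`
  obtain ⟨n', rfl⟩ : ∃ n', n = n' + 1 := ⟨n - 1, by omega⟩
  rw [Finset.sum_range_succ, Finset.sum_range_succ', if_pos rfl, mul_one, Nat.sub_zero, Nat.sub_self,
    ramanujanTau_zero, Int.cast_zero, zero_mul, add_zero]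
  have hIoo : Finset.Ioo 0 (n' + 1) = (Finset.range n').map ⟨fun j => j + 1, fun a b h => by simpa using h⟩ := by
    ext j
    simp only [Finset.mem_Ioo, Finset.mem_map, Finset.mem_range, Function.Embedding.coeFn_mk]
    constructor
    · intro h
      exact ⟨j - 1, by omega, by omega⟩
    · rintro ⟨a, ha, rfl⟩
      omega
  rw [hIoo, Finset.sum_map]
  simp only [Function.Embedding.coeFn_mk, Nat.succ_ne_zero, ↓reduceIte, Nat.add_sub_add_right]
  push_cast
  rw [add_comm, Finset.mul_sum]
  congr 1
  refine Finset.sum_congr rfl fun j _ => ?_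
  ring

end DeltaMulE

/-! ## §2 The constants `C_m = −2m/B_m` -/

section Constants

/-- `−8/B₄ = 240`. [cite: Serre1973, Ch. VII §4.1 (34) (`E₂ = 1 + 240 Σσ₃(n)qⁿ`)] -/
theorem neg_two_mul_div_bernoulli_four : -(2 * (4 : ℕ) / bernoulli 4 : ℂ) = ((240 : ℤ) : ℂ) := by
  rw [bernoulli_eq_bernoulli'_of_ne_one (by norm_num), bernoulli'_four]; push_cast; norm_num

/-- `−12/B₆ = −504`. [cite: Serre1973, Ch. VII §4.1 (34) (`E₃ = 1 − 504 Σσ₅(n)qⁿ`)] -/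
theorem neg_two_mul_div_bernoulli_six : -(2 * (6 : ℕ) / bernoulli 6 : ℂ) = ((-504 : ℤ) : ℂ) := by
  rw [show bernoulli 6 = 1 / 42 by decide +kernel]; push_cast; norm_num

/-- `−16/B₈ = 480`. [cite: Serre1973, Ch. VII §4.1 (34) (`E₄ = 1 + 480 Σσ₇(n)qⁿ`)] -/
theorem neg_two_mul_div_bernoulli_eight : -(2 * (8 : ℕ) / bernoulli 8 : ℂ) = ((480 : ℤ) : ℂ) := by
  rw [bernoulli_eq_bernoulli'_of_ne_one (by norm_num), Literature.NumberTheory.LFunctions.Hinkkanen1997.bernoulli'_8]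
  push_cast; norm_num

/-- `−20/B₁₀ = −264`. [cite: Serre1973, Ch. VII §4.1 (34) (`E₅ = 1 − 264 Σσ₉(n)qⁿ`)] -/
theorem neg_two_mul_div_bernoulli_ten : -(2 * (10 : ℕ) / bernoulli 10 : ℂ) = ((-264 : ℤ) : ℂ) := by
  rw [bernoulli_eq_bernoulli'_of_ne_one (by norm_num), Literature.NumberTheory.LFunctions.Hinkkanen1997.bernoulli'_10]
  push_cast; norm_num

/-- `−28/B₁₄ = −24`. [cite: Serre1973, Ch. VII §4.1 (34) (`E₇ = 1 − 24 Σσ₁₃(n)qⁿ`)] -/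
theorem neg_two_mul_div_bernoulli_fourteen : -(2 * (14 : ℕ) / bernoulli 14 : ℂ) = ((-24 : ℤ) : ℂ) := by
  rw [bernoulli_eq_bernoulli'_of_ne_one (by norm_num), Literature.NumberTheory.LFunctions.Hinkkanen1997.bernoulli'_14]
  push_cast; norm_num

end Constants

/-! ## §3 Manin's congruences -/

section Manin

/-- The common shape: `N ∣ τ(n) + C Σ_{0<j<n} σ_{m−1}(j)τ(n−j) − σ_{m+11}(n)` from Cor. 1.1 for `Δ·E_m`.
[cite: DatskovskyGuerzhoy1996, Cor. 1.1 (list)] -/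
theorem dvd_convolution_sub_sigma_of_weight {m : ℕ} (hm : 3 ≤ m) (hm2 : Even m)
    (hk : 12 + m = 16 ∨ 12 + m = 18 ∨ 12 + m = 20 ∨ 12 + m = 22 ∨ 12 + m = 26) {C : ℤ}
    (hC : -(2 * m / bernoulli m : ℂ) = (C : ℂ)) {n : ℕ} (hn : 0 < n) :
    ((eisensteinNumerator (12 + m) : ℕ) : ℤ) ∣
      ramanujanTau n + C * ∑ j ∈ Finset.Ioo 0 n, (sigma (m - 1) j : ℤ) * ramanujanTau (n - j) -
        sigma (12 + m - 1) n := by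
  have hkZ : ((12 + m : ℕ) : ℤ) = 16 ∨ ((12 + m : ℕ) : ℤ) = 18 ∨ ((12 + m : ℕ) : ℤ) = 20 ∨ ((12 + m : ℕ) : ℤ) = 22 ∨
      ((12 + m : ℕ) : ℤ) = 26 := by omega
  obtain ⟨a, ha, hdvd⟩ := (isNormalizedCuspEigenform_deltaMulE hm hm2 hkZ).congr_sigma_of_weight_mem (Or.inr hk) hn
  rw [coeff_deltaMulE_eq_convolution hm hm2 hC hn] at ha
  have ha' : a = ramanujanTau n + C * ∑ j ∈ Finset.Ioo 0 n, (sigma (m - 1) j : ℤ) * ramanujanTau (n - j) := by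
    exact_mod_cast ha
  rwa [ha'] at hdvd

/-- ★ **Manin, `k = 16`: `σ₁₅(n) ≡ τ(n) + 240 Σ_{m=1}^{n−1} σ₃(m)τ(n−m) (mod 3617)`.**
[cite: DatskovskyGuerzhoy1996, Cor. 1.1 (list, first line)] [cite: Manin1973, ref. 9 of DatskovskyGuerzhoy1996 (corollaries of the coefficients theorem)] -/
theorem manin_sixteen {n : ℕ} (hn : 0 < n) :
    (3617 : ℤ) ∣ ramanujanTau n + 240 * ∑ j ∈ Finset.Ioo 0 n, (sigma 3 j : ℤ) * ramanujanTau (n - j) - sigma 15 n := by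
  have h := dvd_convolution_sub_sigma_of_weight (m := 4) (by norm_num) ⟨2, rfl⟩ (Or.inl rfl)
    neg_two_mul_div_bernoulli_four hn
  rwa [eisensteinNumerator_sixteen] at h

/-- ★ **Manin, `k = 18`: `σ₁₇(n) ≡ τ(n) − 504 Σ_{m=1}^{n−1} σ₅(m)τ(n−m) (mod 43867)`.**
[cite: DatskovskyGuerzhoy1996, Cor. 1.1 (list, second line)] [cite: Manin1973, ref. 9 of DatskovskyGuerzhoy1996 (corollaries of the coefficients theorem)] -/
theorem manin_eighteen {n : ℕ} (hn : 0 < n) :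
    (43867 : ℤ) ∣ ramanujanTau n + (-504) * ∑ j ∈ Finset.Ioo 0 n, (sigma 5 j : ℤ) * ramanujanTau (n - j) -
      sigma 17 n := by
  have h := dvd_convolution_sub_sigma_of_weight (m := 6) (by norm_num) ⟨3, rfl⟩ (Or.inr (Or.inl rfl))
    neg_two_mul_div_bernoulli_six hn
  rwa [eisensteinNumerator_eighteen] at h

/-- ★ **Manin, `k = 20`: `σ₁₉(n) ≡ τ(n) + 480 Σ_{m=1}^{n−1} σ₇(m)τ(n−m) (mod 283·617)`.**
[cite: DatskovskyGuerzhoy1996, Cor. 1.1 (list, third line)] [cite: Manin1973, ref. 9 of DatskovskyGuerzhoy1996 (corollaries of the coefficients theorem)] -/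
theorem manin_twenty {n : ℕ} (hn : 0 < n) :
    (283 * 617 : ℤ) ∣ ramanujanTau n + 480 * ∑ j ∈ Finset.Ioo 0 n, (sigma 7 j : ℤ) * ramanujanTau (n - j) -
      sigma 19 n := by
  have h := dvd_convolution_sub_sigma_of_weight (m := 8) (by norm_num) ⟨4, rfl⟩ (Or.inr (Or.inr (Or.inl rfl)))
    neg_two_mul_div_bernoulli_eight hn
  rwa [eisensteinNumerator_twenty.1] at h

/-- ★ **Manin, `k = 22`: `σ₂₁(n) ≡ τ(n) − 264 Σ_{m=1}^{n−1} σ₉(m)τ(n−m) (mod 131·593)`.**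
[cite: DatskovskyGuerzhoy1996, Cor. 1.1 (list, fourth line)] [cite: Manin1973, ref. 9 of DatskovskyGuerzhoy1996 (corollaries of the coefficients theorem)] -/
theorem manin_twentyTwo {n : ℕ} (hn : 0 < n) :
    (131 * 593 : ℤ) ∣ ramanujanTau n + (-264) * ∑ j ∈ Finset.Ioo 0 n, (sigma 9 j : ℤ) * ramanujanTau (n - j) -
      sigma 21 n := by
  have h := dvd_convolution_sub_sigma_of_weight (m := 10) (by norm_num) ⟨5, rfl⟩
    (Or.inr (Or.inr (Or.inr (Or.inl rfl)))) neg_two_mul_div_bernoulli_ten hn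
  rwa [eisensteinNumerator_twentyTwo.1] at h

/-- ★ **Manin, `k = 26`: `σ₂₅(n) ≡ τ(n) − 24 Σ_{m=1}^{n−1} σ₁₃(m)τ(n−m) (mod 657931)`.**
[cite: DatskovskyGuerzhoy1996, Cor. 1.1 (list, fifth line)] [cite: Manin1973, ref. 9 of DatskovskyGuerzhoy1996 (corollaries of the coefficients theorem)] -/
theorem manin_twentySix {n : ℕ} (hn : 0 < n) :
    (657931 : ℤ) ∣ ramanujanTau n + (-24) * ∑ j ∈ Finset.Ioo 0 n, (sigma 13 j : ℤ) * ramanujanTau (n - j) -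
      sigma 25 n := by
  have h := dvd_convolution_sub_sigma_of_weight (m := 14) (by norm_num) ⟨7, rfl⟩
    (Or.inr (Or.inr (Or.inr (Or.inr rfl)))) neg_two_mul_div_bernoulli_fourteen hn
  rwa [eisensteinNumerator_twentySix] at h

end Manin

end Literature.NumberTheory.ModularForms
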